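import Mathlib.Analysis.Calculus.FDeriv.Prod
import Mathlib.Analysis.Normed.Operator.Prod
import Literature.Geometry.Lorentzian.Basic
import Literature.Geometry.Lorentzian.CoordCurvature
import HarnessLib

/-!
# Crux `GapExhaustion` (stmt-FinalStateConjecture-10808), line `photon-shell-pseudoconvexity`:
# stub (K-C) `stub_killingJetBound_of` — the linear first-order bound on the `1`-jet of a
# Killing field from the prolongation identity

Route `BartnikGapSettling`; helper (`--supports stmt-FinalStateConjecture-10808`) landing the
registered sub-stub (K-C) of the local unique continuation of Killing vector fields from a `1`-jet
(line lead c8, wave 2). In coordinates on an open set `V ⊆ E4` carrying metric components `G`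
(`IsMetricOn G V`, Christoffel map `Γ_x = chrAt G x`, curvature endomorphism `riemAt`), let
`K : E4 → E4` be `C²` on `V` and satisfy the prolongation identity of a Killing field
(O'Neill 1983, Ch. 9, Lemma 9.28 ff.; Kobayashi–Nomizu I, VI.2): for `x ∈ V` and constant `X, Y`,
`∂_X (DK(·) Y + Γ(Y, K ·))(x)
   = R(X, K x) Y − Γ(X, DK(x) Y + Γ(Y, K x)) + DK(x) Γ(X,Y) + Γ(Γ(X,Y), K x)`.
Then the `1`-jet `F x = (K x, DK(x)) ∈ E4 × (E4 →L E4)` (sup norm) satisfies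
`‖DF(x)‖ ≤ c(x) ‖F(x)‖` on `V` with `c` continuous on `V` — the input of the Grönwall uniqueness
argument (K-B) in (K-D).

Proof: `DF(x) = (DK(x), D²K(x))` and `‖DK(x)‖ ≤ ‖F x‖`; by the identity and the product rule for
`y ↦ Γ_y(Y)(K y)`, `D²K(x)(X, Y)` is a sum of nine terms, each bilinear in `(X, Y)` and linear in
`K x` or `DK(x)` with coefficients `Γ_x`, `DΓ(x)`, whence
`‖D²K(x)‖ ≤ 4 (‖Γ_x‖ + ‖Γ_x‖² + ‖DΓ(x)‖) ‖F x‖`; `Γ` is `C^∞` on `V`, so the coefficient is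
continuous there.
-/

noncomputable section

-- instance search through the nested operator types `E4 →L[ℝ] E4 →L[ℝ] E4 →L[ℝ] E4`
set_option maxSynthPendingDepth 3

-- D-0017: single-problem summit, `Summit.<S>.<S>.…` by design (cf. lakefile `weak.linter.dupNamespace`).
set_option linter.dupNamespace false

namespace Summit.FinalStateConjecture.FinalStateConjecture.Theorems

open Set Filter
open Literature.Geometry.Lorentzian Literature.Geometry.Lorentzian.MetricCoord
open scoped Topology ContDiff

/-- A `C²` map on an open set is differentiable at its points. [folklore] -/
private theorem killingJetBound_hasFDerivAt {V : Set E4} {K : E4 → E4} {x : E4} (hV : IsOpen V)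
    (hK : ContDiffOn ℝ 2 K V) (hx : x ∈ V) : HasFDerivAt K (fderiv ℝ K x) x :=
  ((hK.differentiableOn two_ne_zero).differentiableAt (hV.mem_nhds hx)).hasFDerivAt

/-- The derivative of a `C²` map on an open set is differentiable at its points. [folklore] -/
private theorem killingJetBound_hasFDerivAt_fderiv {V : Set E4} {K : E4 → E4} {x : E4}
    (hV : IsOpen V) (hK : ContDiffOn ℝ 2 K V) (hx : x ∈ V) :
    HasFDerivAt (fderiv ℝ K) (fderiv ℝ (fderiv ℝ K) x) x :=
  (((hK.fderiv_of_isOpen hV (m := 1) (by norm_num)).differentiableOn one_ne_zero).differentiableAt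
    (hV.mem_nhds hx)).hasFDerivAt

/-- **The second derivative of `K` through the prolongation identity.** For `x ∈ V`,
`D²K(x)(X)(Y) = ∂_X (DK(·) Y)(x)
   = ∂_X (DK(·) Y + Γ(Y, K ·))(x) − (Γ_x(Y, DK(x) X) + DΓ(x)(X)(Y)(K x))`
(evaluation commutes with differentiation; product rule for `y ↦ Γ_y(Y)(K y)`), the first term
being given by the identity. [folklore] -/
private theorem killingJetBound_fderiv_fderiv_apply {G : E4 → E4 →L[ℝ] E4 →L[ℝ] ℝ} {V : Set E4}
    {K : E4 → E4} {x : E4} (hG : IsMetricOn G V) (hK : ContDiffOn ℝ 2 K V)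
    (hP : ∀ x ∈ V, ∀ X Y : E4,
      fderiv ℝ (fun y => fderiv ℝ K y Y + chrAt G y Y (K y)) x X =
        riemAt G x X (K x) Y - chrAt G x X (fderiv ℝ K x Y + chrAt G x Y (K x))
          + (fderiv ℝ K x (chrAt G x X Y) + chrAt G x (chrAt G x X Y) (K x)))
    (hx : x ∈ V) (X Y : E4) :
    fderiv ℝ (fderiv ℝ K) x X Y =
      riemAt G x X (K x) Y - chrAt G x X (fderiv ℝ K x Y + chrAt G x Y (K x))
        + (fderiv ℝ K x (chrAt G x X Y) + chrAt G x (chrAt G x X Y) (K x))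
        - (chrAt G x Y (fderiv ℝ K x X) + fderiv ℝ (chrAt G) x X Y (K x)) := by
  have hKd := killingJetBound_hasFDerivAt hG.isOpen hK hx
  have hDKd := killingJetBound_hasFDerivAt_fderiv hG.isOpen hK hx
  -- `y ↦ DK(y) Y` has derivative `D²K(x)(·)(Y)`
  have hA : HasFDerivAt (fun y => fderiv ℝ K y Y) ((fderiv ℝ (fderiv ℝ K) x).flip Y) x :=
    hasFDerivAt_clm_apply_const hDKd Y
  -- `y ↦ Γ_y(Y)` has derivative `DΓ(x)(·)(Y)`, and the product rule for `y ↦ Γ_y(Y)(K y)`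
  have hc : HasFDerivAt (fun y => chrAt G y Y) ((fderiv ℝ (chrAt G) x).flip Y) x :=
    hasFDerivAt_clm_apply_const (hG.differentiableAt_chrAt hx).hasFDerivAt Y
  have hB : HasFDerivAt (fun y => chrAt G y Y (K y))
      ((chrAt G x Y).comp (fderiv ℝ K x) + ((fderiv ℝ (chrAt G) x).flip Y).flip (K x)) x :=
    hc.clm_apply hKd
  have h := hP x hx X Y
  rw [(hA.fun_add hB).fderiv] at h
  simp only [_root_.add_apply, ContinuousLinearMap.flip_apply,
    ContinuousLinearMap.comp_apply] at h
  exact eq_sub_of_add_eq h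

/-- `‖T a b c‖ ≤ ‖T‖ ‖a‖ ‖b‖ ‖c‖` for a trilinear map (operator norms). [folklore] -/
private theorem killingJetBound_le_opNorm₃ (T : E4 →L[ℝ] E4 →L[ℝ] E4 →L[ℝ] E4) (a b c : E4) :
    ‖T a b c‖ ≤ ‖T‖ * ‖a‖ * ‖b‖ * ‖c‖ :=
  (T a b).le_of_opNorm_le (T.le_opNorm₂ a b) c

/-- The bookkeeping estimate: for a bilinear `Γ`, a trilinear `DΓ`, a vector `k`, an endomorphism
`D` and vectors `X, Y`, the nine-term expression of `D²K(x)(X)(Y)` (prolongation identity with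
`R(X, k) Y` expanded, `Γ = Γ_x`, `DΓ = DΓ(x)`, `k = K x`, `D = DK(x)`) has norm at most
`4 (‖Γ‖ + ‖Γ‖² + ‖DΓ‖) ‖(k, D)‖ ‖X‖ ‖Y‖`: each term is bounded by operator norms, and
`‖k‖, ‖D‖ ≤ ‖(k, D)‖` (sup norm). [folklore] -/
private theorem killingJetBound_nine_terms (Γ : E4 →L[ℝ] E4 →L[ℝ] E4)
    (DΓ : E4 →L[ℝ] E4 →L[ℝ] E4 →L[ℝ] E4) (k : E4) (D : E4 →L[ℝ] E4) (X Y : E4) :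
    ‖DΓ X k Y - DΓ k X Y + Γ X (Γ k Y) - Γ k (Γ X Y) - Γ X (D Y + Γ Y k)
        + (D (Γ X Y) + Γ (Γ X Y) k) - (Γ Y (D X) + DΓ X Y k)‖ ≤
      4 * (‖Γ‖ + ‖Γ‖ ^ 2 + ‖DΓ‖) * ‖(k, D)‖ * ‖X‖ * ‖Y‖ := by
  have hkN : ‖k‖ ≤ ‖(k, D)‖ := norm_fst_le (k, D)
  have hDN : ‖D‖ ≤ ‖(k, D)‖ := norm_snd_le (k, D)
  -- elementary operator-norm bounds
  have eΓ : ‖Γ X Y‖ ≤ ‖Γ‖ * ‖X‖ * ‖Y‖ := Γ.le_opNorm₂ X Y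
  have ekY : ‖Γ k Y‖ ≤ ‖Γ‖ * ‖(k, D)‖ * ‖Y‖ := (Γ.le_opNorm₂ k Y).trans (by gcongr)
  have eYk : ‖Γ Y k‖ ≤ ‖Γ‖ * ‖Y‖ * ‖(k, D)‖ := (Γ.le_opNorm₂ Y k).trans (by gcongr)
  have eDY : ‖D Y‖ ≤ ‖(k, D)‖ * ‖Y‖ := (D.le_opNorm Y).trans (by gcongr)
  have eDX : ‖D X‖ ≤ ‖(k, D)‖ * ‖X‖ := (D.le_opNorm X).trans (by gcongr)
  have eS : ‖D Y + Γ Y k‖ ≤ ‖(k, D)‖ * ‖Y‖ + ‖Γ‖ * ‖Y‖ * ‖(k, D)‖ := norm_add_le_of_le eDY eYk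
  -- the nine terms
  have h1 : ‖DΓ X k Y‖ ≤ ‖DΓ‖ * ‖X‖ * ‖(k, D)‖ * ‖Y‖ :=
    (killingJetBound_le_opNorm₃ DΓ X k Y).trans (by gcongr)
  have h2 : ‖DΓ k X Y‖ ≤ ‖DΓ‖ * ‖(k, D)‖ * ‖X‖ * ‖Y‖ :=
    (killingJetBound_le_opNorm₃ DΓ k X Y).trans (by gcongr)
  have h3 : ‖Γ X (Γ k Y)‖ ≤ ‖Γ‖ * ‖X‖ * (‖Γ‖ * ‖(k, D)‖ * ‖Y‖) :=
    (Γ.le_opNorm₂ X (Γ k Y)).trans (by gcongr)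
  have h4 : ‖Γ k (Γ X Y)‖ ≤ ‖Γ‖ * ‖(k, D)‖ * (‖Γ‖ * ‖X‖ * ‖Y‖) :=
    (Γ.le_opNorm₂ k (Γ X Y)).trans (by gcongr)
  have h5 : ‖Γ X (D Y + Γ Y k)‖ ≤ ‖Γ‖ * ‖X‖ * (‖(k, D)‖ * ‖Y‖ + ‖Γ‖ * ‖Y‖ * ‖(k, D)‖) :=
    (Γ.le_opNorm₂ X (D Y + Γ Y k)).trans (by gcongr)
  have h6 : ‖D (Γ X Y)‖ ≤ ‖(k, D)‖ * (‖Γ‖ * ‖X‖ * ‖Y‖) := (D.le_opNorm (Γ X Y)).trans (by gcongr)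
  have h7 : ‖Γ (Γ X Y) k‖ ≤ ‖Γ‖ * (‖Γ‖ * ‖X‖ * ‖Y‖) * ‖(k, D)‖ :=
    (Γ.le_opNorm₂ (Γ X Y) k).trans (by gcongr)
  have h8 : ‖Γ Y (D X)‖ ≤ ‖Γ‖ * ‖Y‖ * (‖(k, D)‖ * ‖X‖) := (Γ.le_opNorm₂ Y (D X)).trans (by gcongr)
  have h9 : ‖DΓ X Y k‖ ≤ ‖DΓ‖ * ‖X‖ * ‖Y‖ * ‖(k, D)‖ :=
    (killingJetBound_le_opNorm₃ DΓ X Y k).trans (by gcongr)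
  -- triangle inequality along the shape of the nine-term expression, then bookkeeping
  refine (norm_sub_le_of_le (norm_add_le_of_le (norm_sub_le_of_le (norm_sub_le_of_le
    (norm_add_le_of_le (norm_sub_le_of_le h1 h2) h3) h4) h5) (norm_add_le_of_le h6 h7))
    (norm_add_le_of_le h8 h9)).trans ?_
  have hp1 : 0 ≤ ‖Γ‖ * ‖X‖ * ‖Y‖ * ‖(k, D)‖ := by positivity
  have hp2 : 0 ≤ ‖DΓ‖ * ‖X‖ * ‖Y‖ * ‖(k, D)‖ := by positivity
  linarith

/-- **Pointwise bound of the second derivative through the prolongation identity**: for `x ∈ V`,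
`‖D²K(x)(X)(Y)‖ ≤ 4 (‖Γ_x‖ + ‖Γ_x‖² + ‖DΓ(x)‖) ‖(K x, DK(x))‖ ‖X‖ ‖Y‖`
(`killingJetBound_fderiv_fderiv_apply`, `riemAt_apply` and `killingJetBound_nine_terms`).
[folklore] -/
private theorem killingJetBound_fderiv_fderiv_bound {G : E4 → E4 →L[ℝ] E4 →L[ℝ] ℝ} {V : Set E4}
    {K : E4 → E4} {x : E4} (hG : IsMetricOn G V) (hK : ContDiffOn ℝ 2 K V)
    (hP : ∀ x ∈ V, ∀ X Y : E4,
      fderiv ℝ (fun y => fderiv ℝ K y Y + chrAt G y Y (K y)) x X =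
        riemAt G x X (K x) Y - chrAt G x X (fderiv ℝ K x Y + chrAt G x Y (K x))
          + (fderiv ℝ K x (chrAt G x X Y) + chrAt G x (chrAt G x X Y) (K x)))
    (hx : x ∈ V) (X Y : E4) :
    ‖fderiv ℝ (fderiv ℝ K) x X Y‖ ≤
      4 * (‖chrAt G x‖ + ‖chrAt G x‖ ^ 2 + ‖fderiv ℝ (chrAt G) x‖) * ‖(K x, fderiv ℝ K x)‖
        * ‖X‖ * ‖Y‖ := by
  rw [killingJetBound_fderiv_fderiv_apply hG hK hP hx X Y, riemAt_apply]
  exact killingJetBound_nine_terms (chrAt G x) (fderiv ℝ (chrAt G) x) (K x) (fderiv ℝ K x) X Y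

/-- **Stub (K-C) of the local unique continuation of Killing fields (line
`photon-shell-pseudoconvexity`, crux `GapExhaustion`, stmt-FinalStateConjecture-10808) — the
linear first-order bound on the `1`-jet.**
Let `G` be metric components on the open set `V ⊆ E4` and `K : E4 → E4` a `C²` map on `V`
satisfying the prolongation identity of a Killing field,
`∂_X (DK(·) Y + Γ(Y, K ·))(x)
   = R(X, K x) Y − Γ(X, DK(x) Y + Γ(Y, K x)) + DK(x) Γ(X,Y) + Γ(Γ(X,Y), K x)`
on `V` (O'Neill 1983, Ch. 9, Lemma 9.28 ff.; Kobayashi–Nomizu I, VI.2). Then there is a function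
`c`, continuous on `V`, with `‖D(K, DK)(x)‖ ≤ c(x) ‖(K x, DK(x))‖` for all `x ∈ V` (sup norm on
`E4 × (E4 →L E4)`); explicitly `c(x) = 1 + 4 (‖Γ_x‖ + ‖Γ_x‖² + ‖DΓ(x)‖)`. [folklore] -/
theorem stub_killingJetBound_of :
    ∀ (G : E4 → E4 →L[ℝ] E4 →L[ℝ] ℝ) (V : Set E4) (K : E4 → E4),
      IsMetricOn G V → ContDiffOn ℝ 2 K V →
      (∀ x ∈ V, ∀ X Y : E4,
        fderiv ℝ (fun y => fderiv ℝ K y Y + chrAt G y Y (K y)) x X =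
          riemAt G x X (K x) Y - chrAt G x X (fderiv ℝ K x Y + chrAt G x Y (K x))
            + (fderiv ℝ K x (chrAt G x X Y) + chrAt G x (chrAt G x X Y) (K x))) →
      ∃ c : E4 → ℝ, ContinuousOn c V ∧
        ∀ x ∈ V, ‖fderiv ℝ (fun y => (K y, fderiv ℝ K y)) x‖ ≤ c x * ‖(K x, fderiv ℝ K x)‖ := by
  intro G V K hG hK hP
  refine ⟨fun x => 1 + 4 * (‖chrAt G x‖ + ‖chrAt G x‖ ^ 2 + ‖fderiv ℝ (chrAt G) x‖), ?_, ?_⟩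
  · -- continuity of the coefficient on `V`: `Γ` and `DΓ` are `C^∞` there
    have h1 : ContinuousOn (fun x => ‖chrAt G x‖) V := hG.contDiffOn_chrAt.continuousOn.norm
    have hD : ContDiffOn ℝ ∞ (fderiv ℝ (chrAt G)) V :=
      hG.contDiffOn_chrAt.fderiv_of_isOpen hG.isOpen (by simp)
    have h2 : ContinuousOn (fun x => ‖fderiv ℝ (chrAt G) x‖) V := hD.continuousOn.norm
    exact continuousOn_const.add (continuousOn_const.mul ((h1.add (h1.pow 2)).add h2))
  · intro x hx
    -- `D(K, DK)(x) = (DK(x), D²K(x))`, of norm `max ‖DK(x)‖ ‖D²K(x)‖`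
    have hF : HasFDerivAt (fun y => (K y, fderiv ℝ K y))
        ((fderiv ℝ K x).prod (fderiv ℝ (fderiv ℝ K) x)) x :=
      (killingJetBound_hasFDerivAt hG.isOpen hK hx).prodMk
        (killingJetBound_hasFDerivAt_fderiv hG.isOpen hK hx)
    rw [hF.fderiv, ContinuousLinearMap.opNorm_prod,
      Prod.norm_mk (fderiv ℝ K x) (fderiv ℝ (fderiv ℝ K) x)]
    have hc : 0 ≤ 4 * (‖chrAt G x‖ + ‖chrAt G x‖ ^ 2 + ‖fderiv ℝ (chrAt G) x‖) := by positivity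
    refine max_le ?_ ?_
    · -- `‖DK(x)‖ ≤ ‖(K x, DK(x))‖ ≤ c(x) ‖(K x, DK(x))‖` as `1 ≤ c(x)`
      exact (norm_snd_le (K x, fderiv ℝ K x)).trans
        (le_mul_of_one_le_left (norm_nonneg _) (by linarith))
    · -- `‖D²K(x)‖ ≤ 4 (‖Γ_x‖ + ‖Γ_x‖² + ‖DΓ(x)‖) ‖(K x, DK(x))‖` by the pointwise bound
      refine (ContinuousLinearMap.opNorm_le_bound _ (by positivity) fun X =>
        ContinuousLinearMap.opNorm_le_bound _ (by positivity) fun Y =>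
          killingJetBound_fderiv_fderiv_bound hG hK hP hx X Y).trans ?_
      exact mul_le_mul_of_nonneg_right (by linarith) (norm_nonneg _)

end Summit.FinalStateConjecture.FinalStateConjecture.Theorems

end
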